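import Mathlib
import HarnessLib
import Summits.HubbardSuperconductivity.HubbardSuperconductivity.Theorems.KLProgrammeKLRegimeEngineTowerRemeasureWtAll
import Summits.HubbardSuperconductivity.HubbardSuperconductivity.Theorems.KLProgrammeKLRegimeEngineThinCount6Doors
import Summits.HubbardSuperconductivity.HubbardSuperconductivity.Theorems.KLProgrammeKLRegimeEngineWtBudget
import Summits.HubbardSuperconductivity.HubbardSuperconductivity.Theorems.KLProgrammeKLRegimeWickCrossContractionSupport

/-!
# K3 ENGINE child `KLRegimeEngineV17F2` (stmt-HubbardSuperconductivity-20437), stub (b) closing path, WEIGHTED track: SIX-LEG CELLS AT THE INPUT FAMILY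
# (cell gate-hubbard-kl, seat hubbard-kl-k3c2-p3 g17, row «sector-counting import»; located item «(R1)-COARSENING-READER-UNSOUND» / cure «(C1′)», KL STATUS 2026-08-29 11:13Z)

The W-tower measures the input `𝒱_{dk} = klTowerInput … d k` of block `k` at the INPUT family `F_{dk−1}` (`klTowerMeasWtAt` = sup of
`klWtPinnedSumAt … (d·k−1) j 6 (klTowerInput … d k)`), whereas a six-leg cell stated with `klWtPinnedSum … j 6` measures `𝒱_j` at its OWN family `F_j`.
Since `F_j` vanishes at `t ≥ Λ_j` (`klAnisoFamily_eq_zero_of_le`) while `F_{j−1}` is a partition of unity on `t ≤ Λ_j` and positive up to `Λ_{j−1}`, no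
`T`-generic one-level COARSENING reader exists (the tree's re-sectorisation `hubbardSectorPrescribedSumWt_klAniso_jump_le_split` is refinement-only,
`k + 1 ≤ J′`).  This file supplies the three sound bricks around that fact:

* §1 **(C1′) ⇒ the tower's six-leg import row, by name.**  `klWtPinnedSumAt_six_klTowerInput_le_of_inputFamilyCell` / `klTowerMeasWtAt_six_le_of_inputFamilyCell`:
  a cell of `𝒱_{dk}` AT THE INPUT FAMILY, `∀ q w, klWtPinnedSumOf … (d·k−1) 6 (klEffectiveAction … klE0 (d·k)) q w ≤ B`, bounds every rate-`j ≥ dk−1` pinned sum of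
  `klTowerInput … d k` at `F_{dk−1}` and hence `klTowerMeasWtAt … d k j 6 ≤ B`; **`importRowSix_of_inputFamilyCell`** — in the W-law's floor units: with the free
  amplitude face `B = S̃₆·ε_{dk}²·2^{4dk}` ((R423)(C) (D1)), `W·Z³·(klTowerMeasWtAt … d k j 6 / klLevUnitF β M 0 3 (dk−1)) ≤ 512·W·Z³·S̃₆·(M/β)⁵·ε_{dk}²` (`1 ≤ dk`).
* §2 **(C1′) ⇒ own-family cells, by one-level REFINEMENT.**  `klWtPinnedSum_six_le_of_inputFamilyCell_klEng_flow_all (R c″)`: `∃ C > 0` such that, under the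
  flow-frame binders of `klWtPinnedSumAt_jump_le_klEng_flow_all 5 R c″`, for every `1 ≤ j ≤ n` an input-family cell `≤ B` of `𝒱_j[K_n]` gives the own-family cell
  `klWtPinnedSum … (K_n) j 6 q w ≤ C·16·B` (so the free amplitude `S̃₆ ↦ 16·C·S̃₆`).
* §3 **The (R2) split supplier (refinements only).**  `klWtPinnedSumAt_six_klTowerInput_succ_le_split_klEng_flow_all (R c″)`: `∃ C_c C_r > 0` such that, under the same
  binders, for `2 ≤ d`, `d(k+1) − 1 ≤ n`, rate `j ≥ d(k+1) − 1`: from the OWN-family cell `∀ q w′, klWtPinnedSumOf … (dk) 6 (klTowerInput … d k) q w′ ≤ N` of block `k`'s input,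
  `klWtPinnedSumAt … (d(k+1)−1) j 6 (klTowerInput … d (k+1)) q w ≤ C_c·(2^{d−1})⁴·N + C_r·(2^{d−1})⁴·klTowerBornWtAt … d k j 6`
  (`𝒱_{d(k+1)} = 𝒱_{dk} + Δ_k`, `klTowerInput_succ`; the cell jumped `dk → d(k+1)−1`, the increment re-measured from its born family).
Proofs only (instances + arithmetic); every cell stays a hypothesis (E1); nothing asserts `KernelNormsWt4`, (b), any stub, K3 or superconductivity.
References: BGM 2006 §2.5 (2.45), §2.8 (2.77), (2.82)–(2.84), (2.88)–(2.90) [cite: BenfattoGiulianiMastropietro2006].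
-/

noncomputable section

namespace Summit.HubbardSuperconductivity.HubbardSuperconductivity.Theorems.EngineV8

set_option linter.dupNamespace false -- summit = problem name (single-conjunct summit), D-0017

open Classical
open Real Finset Literature.MathematicalPhysics.QuantumLattice Literature.Probability.LatticeModels GrassmannAlgebra
open Summit.HubbardSuperconductivity.HubbardSuperconductivity.Theorems.KLRegimeSplit
open Summit.HubbardSuperconductivity.HubbardSuperconductivity.Theorems.KLProgrammeLegKernels
open Summit.HubbardSuperconductivity.HubbardSuperconductivity.Theorems.DispersionFlow
open Summit.HubbardSuperconductivity.HubbardSuperconductivity.Theorems.KLRegimeWick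
open Summit.HubbardSuperconductivity.HubbardSuperconductivity.Theorems.TorusFourierL2

variable {L M : ℕ} [NeZero L] [NeZero M]

/-! ## §1 An input-family cell IS the tower's six-leg import row -/

omit [NeZero M] in
/-- **(C1′) ⇒ every rate-`j ≥ dk−1` pinned sum of block `k`'s input at `F_{dk−1}`**: a six-leg cell of `𝒱_{dk}[K]` at the INPUT family `F_{dk−1}`
bounds `klWtPinnedSumAt … (dk−1) j 6 (klTowerInput … d k) q w` (`klTowerInput` is `klEffectiveAction … (d·k)` by `rfl`; the rate only lowers the weight,
`klWtPinnedSumAt_le_klWtPinnedSumOf`). [cite: BenfattoGiulianiMastropietro2006, §2.8 (2.77)] -/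
theorem klWtPinnedSumAt_six_klTowerInput_le_of_inputFamilyCell {β : ℝ} (hβ : 0 ≤ β) (U μ : ℝ) (K : TrigPolyC4v) (d k : ℕ) {j : ℕ}
    (hj : d * k - 1 ≤ j) {B : ℝ}
    (hcell : ∀ (q : Fin 6) (w : SpaceTimeIdx L M × SectorLeg (sectorCount (d * k - 1))),
      klWtPinnedSumOf L M β μ K (d * k - 1) 6 (klEffectiveAction L M β U μ K klE0 (d * k)) q w ≤ B)
    (q : Fin 6) (w : SpaceTimeIdx L M × SectorLeg (sectorCount (d * k - 1))) :
    klWtPinnedSumAt L M β μ K (d * k - 1) j 6 (klTowerInput L M β U μ K d k) q w ≤ B :=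
  (klWtPinnedSumAt_le_klWtPinnedSumOf hβ μ K hj 6 _ q w).trans (hcell q w)

omit [NeZero M] in
/-- **(C1′) ⇒ the measured six-leg array of block `k`**: `klTowerMeasWtAt … d k j 6 ≤ B` for every rate `j ≥ dk − 1` (`0 ≤ B`).
[cite: BenfattoGiulianiMastropietro2006, §2.8 (2.77)] -/
theorem klTowerMeasWtAt_six_le_of_inputFamilyCell {β : ℝ} (hβ : 0 ≤ β) (U μ : ℝ) (K : TrigPolyC4v) (d k : ℕ) {j : ℕ}
    (hj : d * k - 1 ≤ j) {B : ℝ} (hB : 0 ≤ B)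
    (hcell : ∀ (q : Fin 6) (w : SpaceTimeIdx L M × SectorLeg (sectorCount (d * k - 1))),
      klWtPinnedSumOf L M β μ K (d * k - 1) 6 (klEffectiveAction L M β U μ K klE0 (d * k)) q w ≤ B) :
    klTowerMeasWtAt L M β U μ K d k j 6 ≤ B := by
  unfold klTowerMeasWtAt
  rcases isEmpty_or_nonempty (Fin 6 × (SpaceTimeIdx L M × SectorLeg (sectorCount (d * k - 1)))) with he | he
  · rw [Real.iSup_of_isEmpty]; exact hB
  · exact ciSup_le fun qw => klWtPinnedSumAt_six_klTowerInput_le_of_inputFamilyCell hβ U μ K d k hj hcell qw.1 qw.2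

/-- **THE SIX-LEG IMPORT ROW OF THE W-LAW FROM AN INPUT-FAMILY CELL, (D1) free-amplitude face** (`1 ≤ dk`, rate `j ≥ dk−1`, `0 ≤ W, Z, S̃₆`, `0 < β`): if
`∀ q w, klWtPinnedSumOf … (dk−1) 6 (klEffectiveAction … klE0 (dk)) q w ≤ S̃₆·ε_{dk}²·2^{4dk}` then
`W·Z³·(klTowerMeasWtAt … d k j 6 / klLevUnitF β M 0 3 (dk−1)) ≤ 512·W·Z³·S̃₆·(M/β)⁵·ε_{dk}²` (`klLevUnitF_zero_three_eq`: unit `ε_x⁵·2^{4(dk−1)}`; `2^{4dk}/2^{4(dk−1)} = 16`, `1/ε_x⁵ = 32·(M/β)⁵`).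
[cite: BenfattoGiulianiMastropietro2006, §2.8 (2.77)] -/
theorem importRowSix_of_inputFamilyCell {β : ℝ} (hβ : 0 < β) (U μ : ℝ) (K : TrigPolyC4v) (P : SplitConsts) (d k : ℕ) (hdk : 1 ≤ d * k) {j : ℕ}
    (hj : d * k - 1 ≤ j) {W Z S₆ : ℝ} (hW : 0 ≤ W) (hZ : 0 ≤ Z) (hS₆ : 0 ≤ S₆)
    (hcell : ∀ (q : Fin 6) (w : SpaceTimeIdx L M × SectorLeg (sectorCount (d * k - 1))),
      klWtPinnedSumOf L M β μ K (d * k - 1) 6 (klEffectiveAction L M β U μ K klE0 (d * k)) q w ≤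
        S₆ * epsCoupling P U (d * k) ^ 2 * (2 : ℝ) ^ (4 * (d * k))) :
    W * Z ^ 3 * (klTowerMeasWtAt L M β U μ K d k j 6 / klLevUnitF β M 0 3 (d * k - 1)) ≤
      512 * W * Z ^ 3 * S₆ * ((M : ℝ) / β) ^ 5 * epsCoupling P U (d * k) ^ 2 := by
  have hM0 : (0 : ℝ) < M := Nat.cast_pos.2 (Nat.pos_of_ne_zero (NeZero.ne M))
  have hε2 : 0 ≤ epsCoupling P U (d * k) ^ 2 := sq_nonneg _
  have hB : 0 ≤ S₆ * epsCoupling P U (d * k) ^ 2 * (2 : ℝ) ^ (4 * (d * k)) := by positivity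
  have hA := klTowerMeasWtAt_six_le_of_inputFamilyCell hβ.le U μ K d k hj hB hcell
  have hu : 0 < klLevUnitF β M 0 3 (d * k - 1) := klLevUnitF_pos hβ 0 3 (d * k - 1)
  have hr : ((M : ℝ) / β) * imagTimeWeight β M = 1 / 2 := by
    unfold imagTimeWeight; field_simp
  have hr5 : ((M : ℝ) / β) ^ 5 * imagTimeWeight β M ^ 5 = 1 / 32 := by rw [← mul_pow, hr]; norm_num
  have h24 : (2 : ℝ) ^ (4 * (d * k)) = 16 * (2 : ℝ) ^ (4 * (d * k - 1)) := by
    rw [show 4 * (d * k) = 4 * (d * k - 1) + 4 by omega, pow_add]; norm_num; ring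
  rw [mul_div_assoc', div_le_iff₀ hu, klLevUnitF_zero_three_eq]
  calc W * Z ^ 3 * klTowerMeasWtAt L M β U μ K d k j 6 ≤ W * Z ^ 3 * (S₆ * epsCoupling P U (d * k) ^ 2 * (2 : ℝ) ^ (4 * (d * k))) :=
        mul_le_mul_of_nonneg_left hA (by positivity)
    _ = 512 * W * Z ^ 3 * S₆ * ((M : ℝ) / β) ^ 5 * epsCoupling P U (d * k) ^ 2 * (imagTimeWeight β M ^ 5 * (2 : ℝ) ^ (4 * (d * k - 1))) := by
        rw [h24]
        linear_combination (-(512 * W * Z ^ 3 * S₆ * epsCoupling P U (d * k) ^ 2 * (2 : ℝ) ^ (4 * (d * k - 1)))) * hr5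

/-! ## §2 Own-family cells from input-family cells: the one-level refinement `F_{j−1} → F_j` -/

/-- **(C1′) ⇒ (C1): THE OWN-FAMILY SIX-LEG CELL FROM THE INPUT-FAMILY CELL, one refinement level** — `∃ C > 0` and, given `R.WF2`, count thresholds
`c₃′, U₀′ > 0` such that under the binders of `klWtPinnedSumAt_jump_le_klEng_flow_all 5 R c″`, for every `1 ≤ j ≤ n` and every bound `B ≥ 0` of the input-family cell
`∀ q w′, klWtPinnedSumOf … (K_n) (j−1) 6 (klEffectiveAction … (K_n) klE0 j) q w′ ≤ B`:  `∀ q w, klWtPinnedSum … (K_n) j 6 q w ≤ C·16·B`.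
[cite: BenfattoGiulianiMastropietro2006, §2.8 (2.82)-(2.84), (2.88)-(2.90)] -/
theorem klWtPinnedSum_six_le_of_inputFamilyCell_klEng_flow_all (R : RenConsts) (c'' : ℝ) (hc'' : 0 ≤ c'') :
    ∃ C : ℝ, 0 < C ∧ (R.WF2 → ∃ c₃' : ℝ, 0 < c₃' ∧ ∃ U₀' : ℝ, 0 < U₀' ∧
      ∀ (G : GeoConsts) (P : SplitConsts) (Q : EngConsts) (cc : ℝ), 0 < cc → cc ≤ klEngC₃6 P R → cc ≤ c₃' →
      ∀ μ ∈ klWindowC, ∀ U : ℝ, 0 < U → U ≤ min (klEngU₀3 P R cc) (1 / (R.Gfr 3 + 1)) → U ≤ U₀' → c'' * U ≤ 1 →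
      ∀ β : ℝ, klBetaMin ≤ β → β ≤ Real.exp (cc / U ^ 2) →
      ∀ (L M : ℕ) [NeZero L] [NeZero M], klEngL₃ β U ≤ L → klEngM₃ β U L ≤ M →
      ∀ n : ℕ, 1 ≤ n → n ≤ nScales β + 1 → IsKLRegime U cc (-(n : ℤ)) → HistP klPredsV17F2 L M G P Q R β U μ 0 n →
        (∀ m', 1 ≤ m' → m' < n → FlowPieceOscAt L M c'' β U μ m') →
        ∀ j : ℕ, 1 ≤ j → j ≤ n → ∀ B : ℝ, 0 ≤ B →
          (∀ (q : Fin 6) (w' : SpaceTimeIdx L M × SectorLeg (sectorCount (j - 1))),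
            klWtPinnedSumOf L M β μ (klFlowFrameU L M β U μ n) (j - 1) 6
              (klEffectiveAction L M β U μ (klFlowFrameU L M β U μ n) klE0 j) q w' ≤ B) →
          ∀ (q : Fin 6) (w : SpaceTimeIdx L M × SectorLeg (sectorCount j)),
            klWtPinnedSum L M β U μ (klFlowFrameU L M β U μ n) j 6 q w ≤ C * 16 * B) := by
  obtain ⟨C, hC, h⟩ := klWtPinnedSumAt_jump_le_klEng_flow_all 5 R c'' hc''
  refine ⟨C, hC, fun hR2 => ?_⟩
  obtain ⟨c₃', hc₃', U₀', hU₀', h'⟩ := h hR2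
  refine ⟨c₃', hc₃', U₀', hU₀', ?_⟩
  intro G P Q cc hcc hcc6 hcc₃' μ hμ U hU hUle hU₀' hcU β hβmin hβc L M _ _ hL3 hM3 n hn1 hnN hkl hhist hosc j hj1 hjn B hB hcell q w
  have hβ : 0 < β := KLRegimeSplit.pos_of_klBetaMin_le hβmin
  set K : TrigPolyC4v := klFlowFrameU L M β U μ n with hK
  have hjj : j - 1 + 1 ≤ j := by omega
  have hA := h' G P Q cc hcc hcc6 hcc₃' μ hμ U hU hUle hU₀' hcU β hβmin hβc L M hL3 hM3 n hn1 hnN hkl hhist hosc (j - 1) j hjj hjn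
    (klEffectiveAction L M β U μ K klE0 j) (fun m' X hX => klEffectiveAction_momentumConserving β U μ K klE0 j m' X hX) j le_rfl q w B hB
    (fun w' => (klWtPinnedSumAt_le_klWtPinnedSumOf hβ.le μ K (by omega : j - 1 ≤ j) 6 _ q w').trans (hcell q w'))
  rw [show j - (j - 1) = 1 by omega, pow_one, show (5 : ℕ) - 1 = 4 from rfl] at hA
  rw [← klWtPinnedSumOf_klEffectiveAction, ← klWtPinnedSumAt_self]
  calc klWtPinnedSumAt L M β μ K j j 6 (klEffectiveAction L M β U μ K klE0 j) q w ≤ C * (2 : ℝ) ^ 4 * B := hA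
    _ = C * 16 * B := by norm_num

/-! ## §3 The (R2) split supplier: block `k+1`'s input at `F_{d(k+1)−1}` from block `k`'s own-family cell and born size -/

/-- **THE (R2) SPLIT SUPPLIER — refinements only.**  `∃ C_c C_r > 0` and, given `R.WF2`, count thresholds `c₃′, U₀′ > 0` such that under the binders of
`klWtPinnedSumAt_jump_le_klEng_flow_all 5 R c″`, for `2 ≤ d`, `d(k+1) − 1 ≤ n`, rate `j ≥ d(k+1) − 1` and every bound `N ≥ 0` of the OWN-family six-leg cell of block
`k`'s input (`∀ q w′, klWtPinnedSumOf … (K_n) (dk) 6 (klTowerInput … d k) q w′ ≤ N`):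
`klWtPinnedSumAt … (d(k+1)−1) j 6 (klTowerInput … d (k+1)) q w ≤ C_c·(2^{d−1})⁴·N + C_r·(2^{d−1})⁴·klTowerBornWtAt … d k j 6` — `𝒱_{d(k+1)} = 𝒱_{dk} + Δ_k`
(`klTowerInput_succ`), the cell jumped `dk → d(k+1)−1` (`klWtPinnedSumAt_jump_le_klEng_flow_all 5`), the increment re-measured from its born family
(`klWtPinnedSumAt_klTowerIncr_remeasure_le_klEng_flow_all 5`). [cite: BenfattoGiulianiMastropietro2006, §2.8 (2.82)-(2.84), (2.88)-(2.90)] -/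
theorem klWtPinnedSumAt_six_klTowerInput_succ_le_split_klEng_flow_all (R : RenConsts) (c'' : ℝ) (hc'' : 0 ≤ c'') :
    ∃ Cc Cr : ℝ, 0 < Cc ∧ 0 < Cr ∧ (R.WF2 → ∃ c₃' : ℝ, 0 < c₃' ∧ ∃ U₀' : ℝ, 0 < U₀' ∧
      ∀ (G : GeoConsts) (P : SplitConsts) (Q : EngConsts) (cc : ℝ), 0 < cc → cc ≤ klEngC₃6 P R → cc ≤ c₃' →
      ∀ μ ∈ klWindowC, ∀ U : ℝ, 0 < U → U ≤ min (klEngU₀3 P R cc) (1 / (R.Gfr 3 + 1)) → U ≤ U₀' → c'' * U ≤ 1 →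
      ∀ β : ℝ, klBetaMin ≤ β → β ≤ Real.exp (cc / U ^ 2) →
      ∀ (L M : ℕ) [NeZero L] [NeZero M], klEngL₃ β U ≤ L → klEngM₃ β U L ≤ M →
      ∀ n : ℕ, 1 ≤ n → n ≤ nScales β + 1 → IsKLRegime U cc (-(n : ℤ)) → HistP klPredsV17F2 L M G P Q R β U μ 0 n →
        (∀ m', 1 ≤ m' → m' < n → FlowPieceOscAt L M c'' β U μ m') →
        ∀ d k : ℕ, 2 ≤ d → d * (k + 1) - 1 ≤ n → ∀ j : ℕ, d * (k + 1) - 1 ≤ j → ∀ N : ℝ, 0 ≤ N →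
          (∀ (q : Fin 6) (w' : SpaceTimeIdx L M × SectorLeg (sectorCount (d * k))),
            klWtPinnedSumOf L M β μ (klFlowFrameU L M β U μ n) (d * k) 6 (klTowerInput L M β U μ (klFlowFrameU L M β U μ n) d k) q w' ≤ N) →
          ∀ (q : Fin 6) (w : SpaceTimeIdx L M × SectorLeg (sectorCount (d * (k + 1) - 1))),
            klWtPinnedSumAt L M β μ (klFlowFrameU L M β U μ n) (d * (k + 1) - 1) j 6
                (klTowerInput L M β U μ (klFlowFrameU L M β U μ n) d (k + 1)) q w ≤
              Cc * ((2 : ℝ) ^ (d - 1)) ^ 4 * N +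
                Cr * ((2 : ℝ) ^ (d - 1)) ^ 4 * klTowerBornWtAt L M β U μ (klFlowFrameU L M β U μ n) d k j 6) := by
  obtain ⟨Cc, hCc, hc⟩ := klWtPinnedSumAt_jump_le_klEng_flow_all 5 R c'' hc''
  obtain ⟨Cr, hCr, hr⟩ := klWtPinnedSumAt_klTowerIncr_remeasure_le_klEng_flow_all 5 R c'' hc''
  refine ⟨Cc, Cr, hCc, hCr, fun hR2 => ?_⟩
  obtain ⟨c₁, hc₁, U₁, hU₁, hc'⟩ := hc hR2
  obtain ⟨c₂, hc₂, U₂, hU₂, hr'⟩ := hr hR2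
  refine ⟨min c₁ c₂, lt_min hc₁ hc₂, min U₁ U₂, lt_min hU₁ hU₂, ?_⟩
  intro G P Q cc hcc hcc6 hcc₃' μ hμ U hU hUle hU₀' hcU β hβmin hβc L M _ _ hL3 hM3 n hn1 hnN hkl hhist hosc d k hd hkn j hj N hN hcell q w
  have hβ : 0 < β := KLRegimeSplit.pos_of_klBetaMin_le hβmin
  set K : TrigPolyC4v := klFlowFrameU L M β U μ n with hK
  have hjump : d * k + 1 ≤ d * (k + 1) - 1 := by
    have : d * (k + 1) = d * k + d := by ring
    omega
  have hΔ : d * (k + 1) - 1 - d * k = d - 1 := by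
    have : d * (k + 1) = d * k + d := by ring
    omega
  -- the cell term: `𝒱_{dk}` jumped from `F_{dk}` to `F_{d(k+1)−1}`
  have h1 := hc' G P Q cc hcc hcc6 (hcc₃'.trans (min_le_left _ _)) μ hμ U hU hUle (hU₀'.trans (min_le_left _ _)) hcU β hβmin hβc L M hL3 hM3
    n hn1 hnN hkl hhist hosc (d * k) (d * (k + 1) - 1) hjump hkn (klTowerInput L M β U μ K d k)
    (fun m' X hX => by unfold klTowerInput; exact klEffectiveAction_momentumConserving β U μ K klE0 (d * k) m' X hX) j hj q w N hN
    (fun w' => (klWtPinnedSumAt_le_klWtPinnedSumOf hβ.le μ K (by omega : d * k ≤ j) 6 _ q w').trans (hcell q w'))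
  -- the increment term: `Δ_k` re-measured at `F_{d(k+1)−1}` from its born family `F_{dk}`
  have h2 := hr' G P Q cc hcc hcc6 (hcc₃'.trans (min_le_right _ _)) μ hμ U hU hUle (hU₀'.trans (min_le_right _ _)) hcU β hβmin hβc L M hL3 hM3
    n hn1 hnN hkl hhist hosc d (k + 1) k hd (Nat.lt_succ_self k) hkn j hj q w
  rw [hΔ, show (5 : ℕ) - 1 = 4 from rfl] at h1 h2
  rw [klTowerInput_succ]
  exact (klWtPinnedSumAt_add_le hβ.le μ K _ j 6 _ _ q w).trans (add_le_add h1 h2)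

end Summit.HubbardSuperconductivity.HubbardSuperconductivity.Theorems.EngineV8

end
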